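import Mathlib
import HarnessLib
import Summits.CriticalPhenomena.PercolationContinuityZ3.Theses.PercLowPointHalfSpace
import Summits.CriticalPhenomena.PercolationContinuityZ3.Theorems.PercLowPointHalfSpaceLowPointIdentityShift
import Literature.Probability.Percolation.HalfSpacePinnedPairs

/-!
# Crux `LowPointBookkeeping` (stmt-CriticalPhenomena-14713), line `SketchIdeator4` (stem criterion):
# the local objects of the stem inequality — geometry, shift covariance, measurability

Helper file for the registered stub `stub_stemLevel` (the per-level STEM INEQUALITY
`P_p(W_r) ≤ t⁻¹ · E|U ∩ L_r ∩ B_{2r}| + E[|U ∩ L_r ∩ B_r| ; locFoot_r < t]`) of the skeleton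
`Cruxes/LowPointBookkeeping/Lines/SketchIdeator4.lean` (lead a1); lands `--supports stmt-CriticalPhenomena-14713`.
It fixes the LOCAL objects of the footprint-normalised mass transport, all written inline (local notation,
no definitions): for a vertex `x` of `ℤ³` and a radius `s`,

* the sup-norm cube `Q_s(x) = {y | ∀ i, |y i - x i| ≤ s}` and the half-space `ℍ = {0 ≤ x₀}`;
* the localised point-to-wall event `W_r(x) = {x ↔ ∂ℍ inside Q_r(x)}` (for `x = r e₀` this is the event of
  `stub_cubeExit` / `stub_stemLevel`);
* the feet of `x`, `F_r(x)(ω) = {f ∈ ∂ℍ | x ↔ f inside Q_{2r}(x) ∩ ℍ}`, the weight `w_r(x) = 1/|F_r(x)|`, and the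
  local feet of a floor point `a`, `G_r(a)(ω) = {g ∈ ∂ℍ | a ↔ g inside Q_r(a) ∩ ℍ}` (`|G_r(0)|` is the local
  footprint `locFoot_r` of the stub, `G_zero_eq_coe_filter`);

and proves: the cube geometry (`Q_r(f) ∩ ℍ ⊆ Q_{2r}(x) ∩ ℍ` for `f ∈ Q_r(x)`, hence the key inclusion
`G_r(f) ⊆ F_r(x)` for an exit foot `f` of `x`, `G_subset_F`), finiteness, the normalisation identity
`|F| · w = 1`, COVARIANCE of all objects under the horizontal shifts `ω ↦ ω + v`, `v₀ = 0`
(`LowPoint.shift_mem_openConnIn_iff`), and measurability.  The companion file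
`…LowPointBookkeepingStemLevel.lean` runs the two floor mass transports.

References: R. Lyons – Y. Peres, *Probability on Trees and Networks* (2016), §8.2 (mass transport);
G. Grimmett, *Percolation* (1999), §1.6 (translation invariance), §7.2 (paths "in `A`").
-/

noncomputable section

open MeasureTheory Filter Topology
open Literature.Probability.Percolation Literature.Probability.LatticeModels
open scoped ENNReal Classical

namespace Summit.CriticalPhenomena.PercolationContinuityZ3.Theorems.StemCriterion

open Summit.CriticalPhenomena.PercolationContinuityZ3.Theses.PercLowPointHalfSpace
open LowPoint (conn_symm conn_trans conn_refl conn_mono)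

/-- The shift `ω ↦ ω + s` of bond configurations of `ℤ³` (local notation). -/
local notation3 (prettyPrint := false) "𝑻[" s "]" => BondConfig.relabel (sym2Equiv (Site.shift s))

/-- The half-space `ℍ = {0 ≤ x₀}` as written in the route file (local notation). -/
local notation3 (prettyPrint := false) "𝐇" => ({x : Site 3 | 0 ≤ x 0} : Set (Site 3))

/-- The sup-norm cube `Q_s(x) = x + [-s, s]³` (local notation). -/
local notation3 (prettyPrint := false) "𝐐[" x ", " s "]" =>
  ({y : Site 3 | ∀ i : Fin 3, |y i - x i| ≤ ((s : ℕ) : ℤ)} : Set (Site 3))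

/-- The localised point-to-wall event `W_r(x) = {x ↔ ∂ℍ inside Q_r(x)}` (local notation). -/
local notation3 (prettyPrint := false) "𝐖[" x ", " r "]" =>
  ({ω : BondConfig (Site 3) | ∃ f : Site 3, f 0 = 0 ∧ ω ∈ openConnIn 𝐐[x, r] x f} : Set (BondConfig (Site 3)))

/-- The feet of `x`: floor points joined to `x` inside `Q_{2r}(x) ∩ ℍ` (local notation). -/
local notation3 (prettyPrint := false) "𝐅[" x ", " r ", " ω "]" =>
  ({f : Site 3 | f 0 = 0 ∧ ω ∈ openConnIn (𝐐[x, 2 * r] ∩ 𝐇) x f} : Set (Site 3))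

/-- The local feet of a floor point `a`: floor points joined to `a` inside `Q_r(a) ∩ ℍ` (local notation). -/
local notation3 (prettyPrint := false) "𝐆[" a ", " r ", " ω "]" =>
  ({g : Site 3 | g 0 = 0 ∧ ω ∈ openConnIn (𝐐[a, r] ∩ 𝐇) a g} : Set (Site 3))

/-- The transport weight `w_r(x) = 1/|F_r(x)|` (local notation). -/
local notation3 (prettyPrint := false) "𝐰[" x ", " r ", " ω "]" =>
  (((Set.encard 𝐅[x, r, ω] : ℕ∞) : ℝ≥0∞))⁻¹

namespace Stem

/-! ## Cube geometry -/

/-- Cubes are finite. [folklore] -/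
theorem cube_finite (x : Site 3) (s : ℕ) : (𝐐[x, s]).Finite := by
  refine (Set.Finite.pi (t := fun i : Fin 3 => Set.Icc (x i - s) (x i + s))
    fun i => Set.finite_Icc _ _).subset ?_
  intro y hy
  simp only [Set.mem_pi, Set.mem_univ, true_implies, Set.mem_Icc]
  intro i
  have h := abs_le.1 (hy i)
  constructor <;> linarith [h.1, h.2]

/-- A cube rooted at level `r` with radius `r` lies in `ℍ`. [folklore] -/
theorem cube_subset_H {x : Site 3} {r : ℕ} (hx : x 0 = r) : 𝐐[x, r] ⊆ 𝐇 := by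
  intro y hy
  have h := abs_le.1 (hy 0)
  show 0 ≤ y 0
  linarith [h.1]

/-- `Q_r(x) ⊆ Q_{2r}(x) ∩ ℍ` for `x` at level `r`. [folklore] -/
theorem cube_subset_cube_two_inter_H {x : Site 3} {r : ℕ} (hx : x 0 = r) :
    𝐐[x, r] ⊆ 𝐐[x, 2 * r] ∩ 𝐇 := by
  refine Set.subset_inter (fun y hy i => ?_) (cube_subset_H hx)
  have h := hy i
  push_cast
  linarith [abs_nonneg (y i - x i)]

/-- `Q_r(f) ∩ ℍ ⊆ Q_{2r}(x) ∩ ℍ` for `f ∈ Q_r(x)` (triangle inequality). [folklore] -/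
theorem cube_inter_H_subset {x f : Site 3} {r : ℕ} (hf : f ∈ 𝐐[x, r]) :
    𝐐[f, r] ∩ 𝐇 ⊆ 𝐐[x, 2 * r] ∩ 𝐇 := by
  rintro y ⟨hy, hyH⟩
  refine ⟨fun i => ?_, hyH⟩
  have h1 := hy i
  have h2 := hf i
  push_cast
  linarith [abs_sub_le (y i) (f i) (x i)]

/-- If `0 ∈ Q_s(x)` then `x ∈ B_s`. [folklore] -/
theorem mem_box_of_zero_mem_cube {x : Site 3} {s : ℕ} (h : (0 : Site 3) ∈ 𝐐[x, s]) :
    x ∈ box 3 s := by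
  rw [mem_box]
  intro i
  have h' := abs_le.1 (h i)
  simp only [Pi.zero_apply, zero_sub] at h'
  omega

/-- The cube of radius `r` around the origin is the box `B_r`. [folklore] -/
theorem cube_zero_eq_box (r : ℕ) : 𝐐[(0 : Site 3), r] = (↑(box 3 r) : Set (Site 3)) := by
  ext y
  simp only [Set.mem_setOf_eq, Pi.zero_apply, sub_zero, Finset.mem_coe, mem_box, abs_le]

/-! ## The feet: finiteness, normalisation, the key inclusion -/

/-- The feet of `x` lie in `Q_{2r}(x)`; in particular they form a finite set. [folklore] -/
theorem F_finite (x : Site 3) (r : ℕ) (ω : BondConfig (Site 3)) : (𝐅[x, r, ω]).Finite :=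
  (cube_finite x (2 * r)).subset fun _ hf => hf.2.2.1.1

/-- The local feet of `a` form a finite set. [folklore] -/
theorem G_finite (a : Site 3) (r : ℕ) (ω : BondConfig (Site 3)) : (𝐆[a, r, ω]).Finite :=
  (cube_finite a r).subset fun _ hg => hg.2.2.1.1

/-- **Normalisation**: `|F_r(x)| · w_r(x) = 1` as soon as `x` has a foot. [folklore] -/
theorem encard_mul_weight {x : Site 3} {r : ℕ} {ω : BondConfig (Site 3)} (hne : (𝐅[x, r, ω]).Nonempty) :
    ((Set.encard 𝐅[x, r, ω] : ℕ∞) : ℝ≥0∞) * 𝐰[x, r, ω] = 1 := by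
  refine ENNReal.mul_inv_cancel ?_ ?_
  · rw [Ne, ENat.toENNReal_eq_zero, Set.encard_eq_zero]
    exact hne.ne_empty
  · rw [Ne, ENat.toENNReal_eq_top]
    exact (F_finite x r ω).encard_lt_top.ne

/-- An exit foot `f` of `x` (`x ↔ f` inside `Q_r(x)`, `x` at level `r`, `f` on the floor) is a foot of `x`.
[folklore] -/
theorem mem_F_of_exit {x f : Site 3} {r : ℕ} (hx : x 0 = r) (hf0 : f 0 = 0) {ω : BondConfig (Site 3)}
    (hf : ω ∈ openConnIn 𝐐[x, r] x f) : f ∈ 𝐅[x, r, ω] :=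
  ⟨hf0, conn_mono (cube_subset_cube_two_inter_H hx) hf⟩

/-- **The key inclusion**: the local feet of an exit foot `f` of `x` are feet of `x`
(`Q_r(f) ∩ ℍ ⊆ Q_{2r}(x) ∩ ℍ` and `Q_r(x) ⊆ Q_{2r}(x) ∩ ℍ`; concatenate the two open paths). [folklore] -/
theorem G_subset_F {x f : Site 3} {r : ℕ} (hx : x 0 = r) {ω : BondConfig (Site 3)}
    (hf : ω ∈ openConnIn 𝐐[x, r] x f) : 𝐆[f, r, ω] ⊆ 𝐅[x, r, ω] := by
  rintro g ⟨hg0, hg⟩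
  have hfQ : f ∈ 𝐐[x, r] := hf.2.1
  exact ⟨hg0, conn_trans (conn_mono (cube_subset_cube_two_inter_H hx) hf)
    (conn_mono (cube_inter_H_subset hfQ) hg)⟩

/-- If the origin is a foot of `x` then `0 ↔_ℍ x` and `x ∈ B_{2r}`. [folklore] -/
theorem conn_H_of_zero_mem_F {x : Site 3} {r : ℕ} {ω : BondConfig (Site 3)} (h : (0 : Site 3) ∈ 𝐅[x, r, ω]) :
    ω ∈ openConnIn 𝐇 0 x ∧ x ∈ box 3 (2 * r) :=
  ⟨conn_symm (conn_mono Set.inter_subset_right h.2), mem_box_of_zero_mem_cube h.2.2.1.1⟩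

/-- If `x ↔ 0` inside `Q_r(x)` (with `x` at level `r`) then `0 ↔_ℍ x` and `x ∈ B_r`. [folklore] -/
theorem conn_H_of_conn_cube_zero {x : Site 3} {r : ℕ} (hx : x 0 = r) {ω : BondConfig (Site 3)}
    (h : ω ∈ openConnIn 𝐐[x, r] x 0) : ω ∈ openConnIn 𝐇 0 x ∧ x ∈ box 3 r :=
  ⟨conn_symm (conn_mono (cube_subset_H hx) h), mem_box_of_zero_mem_cube h.2.1⟩

/-- The local feet of the origin are the points counted by the stub's local footprint:
`G_r(0) = {g ∈ B_r | g₀ = 0, 0 ↔ g inside B_r ∩ ℍ}`. [folklore] -/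
theorem G_zero_eq_coe_filter (r : ℕ) (ω : BondConfig (Site 3)) :
    𝐆[(0 : Site 3), r, ω] = ↑((box 3 r).filter fun g : Site 3 =>
      g 0 = 0 ∧ ω ∈ openConnIn ((↑(box 3 r) : Set (Site 3)) ∩ 𝐇) 0 g) := by
  ext g
  rw [cube_zero_eq_box]
  simp only [Set.mem_setOf_eq, Finset.coe_filter]
  constructor
  · rintro ⟨hg0, hg⟩
    exact ⟨hg.2.1.1, hg0, hg⟩
  · rintro ⟨-, hg0, hg⟩
    exact ⟨hg0, hg⟩

/-- The number of local feet of the origin is the stub's local footprint `locFoot_r`. [folklore] -/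
theorem ncard_G_zero (r : ℕ) (ω : BondConfig (Site 3)) :
    (𝐆[(0 : Site 3), r, ω]).ncard = ((box 3 r).filter fun g : Site 3 =>
      g 0 = 0 ∧ ω ∈ openConnIn ((↑(box 3 r) : Set (Site 3)) ∩ 𝐇) 0 g).card := by
  rw [G_zero_eq_coe_filter, Set.ncard_coe_finset]

/-! ## Covariance under horizontal shifts -/

/-- Cubes are translated by translations. [folklore] -/
theorem preimage_add_cube (x v : Site 3) (s : ℕ) :
    ((fun y : Site 3 => y + v) ⁻¹' 𝐐[x + v, s]) = 𝐐[x, s] := by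
  ext y
  simp only [Set.mem_preimage, Set.mem_setOf_eq, Pi.add_apply, add_sub_add_right_eq_sub]

/-- Horizontal translations preserve `ℍ`. [folklore] -/
theorem preimage_add_H {v : Site 3} (hv : v 0 = 0) : ((fun y : Site 3 => y + v) ⁻¹' 𝐇) = 𝐇 := by
  ext y
  simp only [Set.mem_preimage, Set.mem_setOf_eq, Pi.add_apply, hv, add_zero]

/-- Horizontal translations carry `Q_s(x) ∩ ℍ` to `Q_s(x + v) ∩ ℍ`. [folklore] -/
theorem preimage_add_cube_inter_H (x : Site 3) {v : Site 3} (hv : v 0 = 0) (s : ℕ) :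
    ((fun y : Site 3 => y + v) ⁻¹' (𝐐[x + v, s] ∩ 𝐇)) = 𝐐[x, s] ∩ 𝐇 := by
  rw [Set.preimage_inter, preimage_add_cube, preimage_add_H hv]

/-- Covariance of `{x ↔ a inside Q_s(x)}` under any shift. [folklore] -/
theorem shift_mem_connCube_iff (x a v : Site 3) (s : ℕ) (ω : BondConfig (Site 3)) :
    𝑻[v] ω ∈ openConnIn 𝐐[x + v, s] (x + v) (a + v) ↔ ω ∈ openConnIn 𝐐[x, s] x a := by
  rw [LowPoint.shift_mem_openConnIn_iff, preimage_add_cube]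

/-- Covariance of `{a ↔ b inside Q_s(x) ∩ ℍ}` under horizontal shifts. [folklore] -/
theorem shift_mem_connCubeH_iff (x a b : Site 3) {v : Site 3} (hv : v 0 = 0) (s : ℕ)
    (ω : BondConfig (Site 3)) :
    𝑻[v] ω ∈ openConnIn (𝐐[x + v, s] ∩ 𝐇) (a + v) (b + v) ↔ ω ∈ openConnIn (𝐐[x, s] ∩ 𝐇) a b := by
  rw [LowPoint.shift_mem_openConnIn_iff, preimage_add_cube_inter_H x hv]

/-- Covariance of the localised point-to-wall event under horizontal shifts. [folklore] -/
theorem shift_mem_W_iff (x : Site 3) {v : Site 3} (hv : v 0 = 0) (r : ℕ) (ω : BondConfig (Site 3)) :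
    𝑻[v] ω ∈ 𝐖[x + v, r] ↔ ω ∈ 𝐖[x, r] := by
  simp only [Set.mem_setOf_eq]
  constructor
  · rintro ⟨f, hf0, hf⟩
    refine ⟨f - v, by simp [hv, hf0], ?_⟩
    rw [← shift_mem_connCube_iff x (f - v) v r ω, sub_add_cancel]
    exact hf
  · rintro ⟨f, hf0, hf⟩
    exact ⟨f + v, by simp [hv, hf0], (shift_mem_connCube_iff x f v r ω).2 hf⟩

/-- Covariance of the feet: `f + v ∈ F_r(x + v)(ω + v) ↔ f ∈ F_r(x)(ω)`. [folklore] -/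
theorem add_mem_F_shift_iff (x f : Site 3) {v : Site 3} (hv : v 0 = 0) (r : ℕ) (ω : BondConfig (Site 3)) :
    f + v ∈ 𝐅[x + v, r, 𝑻[v] ω] ↔ f ∈ 𝐅[x, r, ω] := by
  have h0 : (f + v) 0 = 0 ↔ f 0 = 0 := by rw [Pi.add_apply, hv, add_zero]
  simp only [Set.mem_setOf_eq]
  rw [h0, shift_mem_connCubeH_iff x x f hv (2 * r) ω]

/-- The feet of the shifted configuration are the shifted feet. [folklore] -/
theorem F_shift_eq (x : Site 3) {v : Site 3} (hv : v 0 = 0) (r : ℕ) (ω : BondConfig (Site 3)) :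
    𝐅[x + v, r, 𝑻[v] ω] = (fun f : Site 3 => f - v) ⁻¹' 𝐅[x, r, ω] := by
  ext f
  rw [Set.mem_preimage, ← add_mem_F_shift_iff x (f - v) hv r ω, sub_add_cancel]

/-- The number of feet is shift invariant. [folklore] -/
theorem encard_F_shift (x : Site 3) {v : Site 3} (hv : v 0 = 0) (r : ℕ) (ω : BondConfig (Site 3)) :
    (𝐅[x + v, r, 𝑻[v] ω]).encard = (𝐅[x, r, ω]).encard := by
  rw [F_shift_eq x hv r ω, Set.encard_preimage_of_injective_subset_range sub_left_injective
    (fun u _ => ⟨u + v, add_sub_cancel_right u v⟩)]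

/-- The weight is shift invariant. [folklore] -/
theorem weight_shift (x : Site 3) {v : Site 3} (hv : v 0 = 0) (r : ℕ) (ω : BondConfig (Site 3)) :
    𝐰[x + v, r, 𝑻[v] ω] = 𝐰[x, r, ω] := by
  rw [encard_F_shift x hv r ω]

/-- Covariance of the local feet: `g + v ∈ G_r(a + v)(ω + v) ↔ g ∈ G_r(a)(ω)`. [folklore] -/
theorem add_mem_G_shift_iff (a g : Site 3) {v : Site 3} (hv : v 0 = 0) (r : ℕ) (ω : BondConfig (Site 3)) :
    g + v ∈ 𝐆[a + v, r, 𝑻[v] ω] ↔ g ∈ 𝐆[a, r, ω] := by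
  have h0 : (g + v) 0 = 0 ↔ g 0 = 0 := by rw [Pi.add_apply, hv, add_zero]
  simp only [Set.mem_setOf_eq]
  rw [h0, shift_mem_connCubeH_iff a a g hv r ω]

/-- The number of local feet is shift invariant. [folklore] -/
theorem ncard_G_shift (a : Site 3) {v : Site 3} (hv : v 0 = 0) (r : ℕ) (ω : BondConfig (Site 3)) :
    (𝐆[a + v, r, 𝑻[v] ω]).ncard = (𝐆[a, r, ω]).ncard := by
  have h : 𝐆[a + v, r, 𝑻[v] ω] = (fun g : Site 3 => g - v) ⁻¹' 𝐆[a, r, ω] := by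
    ext g
    rw [Set.mem_preimage, ← add_mem_G_shift_iff a (g - v) hv r ω, sub_add_cancel]
  rw [h, Set.ncard_preimage_of_injective_subset_range sub_left_injective
    (fun u _ => ⟨u + v, add_sub_cancel_right u v⟩)]

/-! ## Measurability -/

/-- The localised point-to-wall event is measurable. [folklore] -/
theorem measurableSet_W (x : Site 3) (r : ℕ) : MeasurableSet 𝐖[x, r] := by
  have h : 𝐖[x, r] = ⋃ f ∈ {f : Site 3 | f 0 = 0}, openConnIn 𝐐[x, r] x f := by
    ext ω
    simp only [Set.mem_setOf_eq, Set.mem_iUnion, exists_prop]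
  rw [h]
  exact MeasurableSet.biUnion (Set.to_countable _) fun f _ => measurableSet_openConnIn_of_countable _ _ _

/-- `{ω | f ∈ F_r(x)(ω)}` is measurable. [folklore] -/
theorem measurableSet_mem_F (x f : Site 3) (r : ℕ) :
    MeasurableSet {ω : BondConfig (Site 3) | f ∈ 𝐅[x, r, ω]} := by
  simp only [Set.setOf_and]
  exact (MeasurableSet.const _).inter (measurableSet_openConnIn_of_countable _ _ _)

/-- `ω ↦ F_r(x)(ω)` is measurable. [folklore] -/
theorem measurable_F (x : Site 3) (r : ℕ) : Measurable fun ω : BondConfig (Site 3) => 𝐅[x, r, ω] :=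
  measurable_set_iff.2 fun f => measurableSet_setOf.1 (measurableSet_mem_F x f r)

/-- The weight `ω ↦ w_r(x)(ω)` is measurable. [folklore] -/
theorem measurable_weight (x : Site 3) (r : ℕ) : Measurable fun ω : BondConfig (Site 3) => 𝐰[x, r, ω] :=
  ((Measurable.of_discrete (f := fun n : ℕ∞ => (n : ℝ≥0∞))).comp
    (measurable_encard.comp (measurable_F x r))).inv

/-- `ω ↦ G_r(a)(ω)` is measurable. [folklore] -/
theorem measurable_G (a : Site 3) (r : ℕ) : Measurable fun ω : BondConfig (Site 3) => 𝐆[a, r, ω] := by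
  refine measurable_set_iff.2 fun g => measurableSet_setOf.1 ?_
  simp only [Set.setOf_and]
  exact (MeasurableSet.const _).inter (measurableSet_openConnIn_of_countable _ _ _)

/-- The number of local feet, as a real number, is measurable. [folklore] -/
theorem measurable_ncard_G (a : Site 3) (r : ℕ) :
    Measurable fun ω : BondConfig (Site 3) => ((𝐆[a, r, ω]).ncard : ℝ) :=
  (measurable_from_nat (f := fun n : ℕ => (n : ℝ))).comp (measurable_ncard.comp (measurable_G a r))

/-- The thin event `{|G_r(a)| < t}` is measurable. [folklore] -/
theorem measurableSet_thin (a : Site 3) (r : ℕ) (t : ℝ) :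
    MeasurableSet {ω : BondConfig (Site 3) | ((𝐆[a, r, ω]).ncard : ℝ) < t} :=
  measurableSet_lt (measurable_ncard_G a r) measurable_const

end Stem

/-! ## Registered form -/

/-- **Registered sub-goal `stub_stemKeyInclusion`** (crux stmt-CriticalPhenomena-14713, line SketchIdeator4, helper of
`stub_stemLevel`): the key inclusion of the stem inequality — the local feet `G_r(f)` of an exit foot `f` of an
apex `x` at level `r` (`x ↔ f` inside `Q_r(x)`) are feet of `x` (joined to `x` inside `Q_{2r}(x) ∩ ℍ`). [folklore] -/
theorem stub_stemKeyInclusion : ∀ (x f : Site 3) (r : ℕ), x 0 = (r : ℤ) → ∀ ω : BondConfig (Site 3), ω ∈ openConnIn {y : Site 3 | ∀ i : Fin 3, |y i - x i| ≤ (r : ℤ)} x f → {g : Site 3 | g 0 = 0 ∧ ω ∈ openConnIn ({y : Site 3 | ∀ i : Fin 3, |y i - f i| ≤ (r : ℤ)} ∩ {x : Site 3 | 0 ≤ x 0}) f g} ⊆ {g : Site 3 | g 0 = 0 ∧ ω ∈ openConnIn ({y : Site 3 | ∀ i : Fin 3, |y i - x i| ≤ ((2 * r : ℕ) : ℤ)}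 ∩ {x : Site 3 | 0 ≤ x 0}) x g} :=
  fun _ _ _ hx _ hf => Stem.G_subset_F hx hf

end Summit.CriticalPhenomena.PercolationContinuityZ3.Theorems.StemCriterion

end
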